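import Summits.HodgeConjecture.HodgeConjecture.Theorems.R90S4CubicCartanStableClass              -- ★ p863813 (this seat): the `Gqs` frame (brings ★ FILE 1/2, `R90S4StableClassCartanType`, `F0P3cStCharTSCartanFin`, `QuadraticLocalNormGroupNonsplit`, `Weil1982.UnitaryLocalRingBaseField`)
import Literature.NumberTheory.GaloisRepresentations.LocalFieldFiniteExtension                -- ★ `FiniteExtension.exists_isNonarchimedeanLocalField` (a finite extension of a local field is a local field)
import Literature.NumberTheory.Automorphic.AdicCompletionLocalField                          -- ★ `IsNonarchimedeanLocalField (v.adicCompletion K)` (instance)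
import Literature.NumberTheory.Automorphic.QuadraticLocalBaseChange                          -- ★ `algebraLocalRing`, `conjLocal_toLocalRing`, `moduleFinite_localRing`
import HarnessLib

/-!
# R90-TF · S4 «Ch. 13.1–2», (DICT) sub-brick (2), FILE 2a — THE CORNER FIELD OF A TYPE-(2) CARTAN ALGEBRA: for a regular `γ ∈ U(Φ₃)(L⁺_v)` and a `⋆`-fixed idempotent `e ∈ Z(γ)`
# whose corner `(1−e)Z(γ)` is a field, the `⋆`-fixed units of the corner fall into exactly TWO classes modulo `⋆`-norms (Rogawski 1990, §3.5 Prop. 3.5.2 pp. 25–26, §3.6 pp. 28–29)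

Cell `hodgecm-mathlib`, crux H413 (`stmt-HodgeConjecture-24833`, lane `--supports … --as helper`), route of record `HCCMUnconditional` (no route verbs; count-neutral).
Programme R90-TF, section S4, dealer K2E2-plan (g7): deal «(DICT)(2) `K¹ × E¹`» (`R90/STATUS.md` 2026-09-05T00:55:10Z), GO F1 01:12:40Z; seat K2E3-p27 (g3).
THEOREMS ONLY — no `def`, no instance, no notation, no `sorry`; ★-only imports.  Consumer: FILE 2b `R90S4TypeTwoNormClassesCover` (the four-class cover feeding ★ FILE 1
`R90S4StableConjTwoClassesOfNormClassesFour.exists_unitary_conj_or_of_normClasses_four`).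

## THE MATHEMATICS
`v` non-split (so `L ⊗ L⁺_v = L_w` is a field), `⋆ = hermStar (c ⊗ 1) Φ₃`, `γ ∈ Gqs L v` regular, `Z = Z(γ) ⊆ M₃(L_w)` its (commutative, `⋆`-stable) Cartan algebra, `e ∈ Z` with
`e² = e = e⋆ ≠ 1` and FIELD CORNER: every `x ∈ Z` with `(1−e)x ≠ 0` has `y ∈ Z` with `(1−e)xy = 1−e`.  Then `Q := Z∕(e) ≅ (1−e)Z` is a field, `⋆` descends to an involution `τ` of
`Q` with `τ ≠ id` (it moves the scalars `δ·1`, `c(δ) = −δ`), and `Q` is a finite extension of the local field `F_v = L⁺_v` (through `F_v → L_w → Z → Q`; ★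
`FiniteExtension.exists_isNonarchimedeanLocalField`), so ★ B-typ04 `LocalFieldInvolutionNorm.exists_fixed_nonnorm_dichotomy` applies: `[Q^{τ×} : N(Q^×)] = 2`.  Read back in
`Z` modulo `e` this is **`exists_corner_dichotomy_of_typeTwo`**: a `⋆`-fixed (mod `e`) corner-unit `c ∈ Z` which is not killed by any corner-norm, such that every `⋆`-fixed
corner-unit `s` satisfies `(1−e)·s·(β⋆β) ∈ {(1−e), (1−e)c}` for some corner-unit `β ∈ Z` [§3.6: for `T = T_K × E¹`, `Z ≅ E_w × L₄` and `c` generates `L₄^{τ×}∕N`].  The proof keeps a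
single instance path on `Z` (`Subalgebra.toRing`) and on `Q` (its field structure), which is what makes the elaboration cheap.

## CONTENTS
* §1 `hermStar_sub'`; §2 **`exists_corner_dichotomy_of_typeTwo`**.

HONEST LABEL: HC_CM is proved only modulo the 7 printed citations (2 remaining named inputs: hLiu418 = stmt-HodgeConjecture-24832, h413 = stmt-HodgeConjecture-24833) until rung 0
closes.  Local algebra toward the (DICT) payer of (B2-S); discharges no named input; (W-NP) ∕ (B2-S) OPEN.  REL ≠ ★ ≠ BUILT.

## References
* [Rogawski1990] J. D. Rogawski, *Automorphic Representations of Unitary Groups in Three Variables*, Ann. of Math. Stud. 123 (1990), §3.5 Prop. 3.5.2 pp. 25–26, §3.6 pp. 28–29.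
* [Serre1979] J.-P. Serre, *Local Fields*, GTM 67 (1979), Ch. II §2 Prop. 3; Ch. XIV §2.
-/

set_option autoImplicit false
set_option linter.dupNamespace false

noncomputable section

open NumberField IsDedekindDomain
open scoped Matrix MatrixGroups
open Literature.NumberTheory.Rogawski1990 Literature.NumberTheory.Automorphic Literature.NumberTheory.Automorphic.UnitaryGroup
open Literature.NumberTheory.GaloisRepresentations Literature.NumberTheory.LocalFields
open Literature.AlgebraicGeometry.ShimuraVarieties (unitaryGroup mem_unitaryGroup_iff)
open Summit.HodgeConjecture.HodgeConjecture.Cruxes.H413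

namespace Summit.HodgeConjecture.HodgeConjecture.R90.S4

section HermStarSub

variable {R : Type*} [CommRing R] {n : Type*} [Fintype n] [DecidableEq n] (σ : R →+* R) (H : Matrix n n R)

/-- `(x − y)⋆ = x⋆ − y⋆`. [cite: Rogawski1990, §3.5 p. 25] -/
theorem hermStar_sub' (x y : Matrix n n R) : hermStar σ H (x - y) = hermStar σ H x - hermStar σ H y := by
  have hmap : (x - y).map σ = x.map σ - y.map σ := by
    ext i j
    simp only [Matrix.map_apply, Matrix.sub_apply, map_sub]
  rw [hermStar_def, hermStar_def, hermStar_def, hmap, Matrix.transpose_sub, Matrix.mul_sub, Matrix.sub_mul]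

end HermStarSub

section TypeTwo

variable (L : Type) [Field L] [NumberField L] [IsCMField L] (v : HeightOneSpectrum (𝓞 ↥(maximalRealSubfield L)))

variable {L v} in
set_option maxHeartbeats 400000 in -- ≈ 270k measured: instance synthesis on `M₃(∏_{w∣v} L_w)`, its Cartan subalgebra and the quotient field dominates; no single step > 1 s
/-- **THE CORNER FIELD OF A TYPE-(2) CARTAN ALGEBRA: two norm classes.**  `v` non-split; `γ ∈ Gqs L v` regular, `Z = Z(γ)`, `⋆ = hermStar (c ⊗ 1) Φ₃`; `e ∈ Z` with
`e² = e = e⋆`, `e ≠ 1`, and FIELD CORNER `∀ x ∈ Z, (1−e)x ≠ 0 → ∃ y ∈ Z, (1−e)xy = 1−e`.  Then there is `c ∈ Z`, `⋆`-fixed and invertible modulo `e`, NOT KILLED modulo `e` by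
any `⋆`-norm `t⋆t` of an (mod `e`) invertible `t ∈ Z`, such that every `s ∈ Z` which is `⋆`-fixed and non-zero modulo `e` satisfies `(1−e)·s·(β⋆β) = (1−e)` or `= (1−e)·c` for some
`β ∈ Z` invertible modulo `e` — i.e. `Q := Z∕(e)` is a field on which `⋆` induces an involution `τ ≠ id`, `Q ∕ F_v` is finite, and `[Q^{τ×} : N(Q^×)] = 2` (★ B-typ04).
[cite: Rogawski1990, §3.5 Prop. 3.5.2 pp. 25–26; §3.6 pp. 28–29] [cite: Serre1979, Ch. II §2 Prop. 3; Ch. XIV §2] -/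
theorem exists_corner_dichotomy_of_typeTwo (hns : ∀ w : PlacesOver L v, IsCMField.complexConj L • w.1 = w.1) {γ : Gqs L v}
    (hreg : IsRegularElt (γ.val : GL (Fin 3) (LocalRing L v)))
    {e : Matrix (Fin 3) (Fin 3) (LocalRing L v)} (heZ : e ∈ cartanAlgebra (γ.val.val : Matrix (Fin 3) (Fin 3) (LocalRing L v))) (hee : e * e = e)
    (hes : hermStar (conjLocal L (IsCMField.complexConj L) v) (cmLocalForm L 3 v) e = e) (he1 : e ≠ 1)
    (hcorner : ∀ x ∈ cartanAlgebra (γ.val.val : Matrix (Fin 3) (Fin 3) (LocalRing L v)), (1 - e) * x ≠ 0 → ∃ y ∈ cartanAlgebra (γ.val.val : Matrix (Fin 3) (Fin 3) (LocalRing L v)), (1 - e) * (x * y) = 1 - e) :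
    ∃ c ∈ cartanAlgebra (γ.val.val : Matrix (Fin 3) (Fin 3) (LocalRing L v)),
      (1 - e) * hermStar (conjLocal L (IsCMField.complexConj L) v) (cmLocalForm L 3 v) c = (1 - e) * c ∧
      (∃ c' ∈ cartanAlgebra (γ.val.val : Matrix (Fin 3) (Fin 3) (LocalRing L v)), (1 - e) * (c * c') = 1 - e) ∧
      (∀ t ∈ cartanAlgebra (γ.val.val : Matrix (Fin 3) (Fin 3) (LocalRing L v)), (∃ t' ∈ cartanAlgebra (γ.val.val : Matrix (Fin 3) (Fin 3) (LocalRing L v)), (1 - e) * (t * t') = 1 - e) →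
        (1 - e) * (c * (hermStar (conjLocal L (IsCMField.complexConj L) v) (cmLocalForm L 3 v) t * t)) ≠ 1 - e) ∧
      ∀ s ∈ cartanAlgebra (γ.val.val : Matrix (Fin 3) (Fin 3) (LocalRing L v)),
        (1 - e) * hermStar (conjLocal L (IsCMField.complexConj L) v) (cmLocalForm L 3 v) s = (1 - e) * s → (1 - e) * s ≠ 0 →
        ∃ β ∈ cartanAlgebra (γ.val.val : Matrix (Fin 3) (Fin 3) (LocalRing L v)), ∃ β' ∈ cartanAlgebra (γ.val.val : Matrix (Fin 3) (Fin 3) (LocalRing L v)), (1 - e) * (β * β') = 1 - e ∧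
          ((1 - e) * (s * (hermStar (conjLocal L (IsCMField.complexConj L) v) (cmLocalForm L 3 v) β * β)) = 1 - e ∨
           (1 - e) * (s * (hermStar (conjLocal L (IsCMField.complexConj L) v) (cmLocalForm L 3 v) β * β)) = (1 - e) * c) := by
  classical
  obtain ⟨w⟩ := (inferInstance : Nonempty (PlacesOver L v))
  have hw := hns w
  have hF : IsField (LocalRing L v) := LocalRing.isField_of_smul_eq (IsCMField.complexConj L) (IsCMField.complexConj_ne_one L) w hw
  have hunit : ∀ a : LocalRing L v, a ≠ 0 → IsUnit a := by
    intro a ha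
    obtain ⟨b, hb⟩ := hF.mul_inv_cancel ha
    exact IsUnit.of_mul_eq_one b hb
  haveI : Algebra.IsQuadraticExtension ↥(maximalRealSubfield L) L := IsCMField.isQuadraticExtension L
  -- ### notation and the letters of the quasi-split local form (no `Field` instance on `L ⊗ L⁺_v`: one instance path throughout)
  set σ : LocalRing L v →+* LocalRing L v := conjLocal L (IsCMField.complexConj L) v with hσ_def
  set Hm : Matrix (Fin 3) (Fin 3) (LocalRing L v) := cmLocalForm L 3 v with hHm_def
  set γm : Matrix (Fin 3) (Fin 3) (LocalRing L v) := γ.val.val with hγm_def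
  set Z := cartanAlgebra γm with hZ_def
  have hH : IsUnit Hm.det := by
    rw [hHm_def, cmLocalForm_eq_over]
    exact (Matrix.isUnit_iff_isUnit_det _).1 ((StdForm.antidiagonal 3).isUnit_over _)
  have hHh : (Hm.map σ)ᵀ = Hm := by rw [hHm_def, hσ_def, cmLocalForm_eq_over, StdForm.over_map, StdForm.transpose_over]
  have hσσ : ∀ r : LocalRing L v, σ (σ r) = r := Literature.NumberTheory.Weil1982.UnitaryFinTopForm.conjLocal_conjLocal L v
  have hγU : (γ.val : GL (Fin 3) (LocalRing L v)) ∈ unitaryGroup σ Hm := γ.2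
  have hsep : γm.charpoly.Separable := hreg
  have hcomm : ∀ a b : Matrix (Fin 3) (Fin 3) (LocalRing L v), a ∈ Z → b ∈ Z → a * b = b * a := by
    letI : Field (LocalRing L v) := hF.toField
    intro a b ha hb
    exact mul_comm_of_mem_cartanAlgebra hsep ha hb
  have hstar : ∀ a : Matrix (Fin 3) (Fin 3) (LocalRing L v), a ∈ Z → hermStar σ Hm a ∈ Z := fun a ha => hermStar_mem_cartanAlgebra σ Hm hH hγU ha
  obtain ⟨δ, hcδ, hδ⟩ := Literature.NumberTheory.Weil1982.UnitaryFinTopForm.exists_complexConj_eq_neg_ne_zero L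
  have h1e : (1 - e) * e = 0 := by rw [Matrix.sub_mul, Matrix.one_mul, hee, sub_self]
  have h1eZ : (1 - e) ∈ Z := Subalgebra.sub_mem _ (Subalgebra.one_mem _) heZ
  have h1e0 : (1 : Matrix (Fin 3) (Fin 3) (LocalRing L v)) - e ≠ 0 := sub_ne_zero.2 (Ne.symm he1)
  -- ### the commutative ring `Z` (one instance root: `Subalgebra.toRing Z`) and the involution `τ = ⋆|_Z`
  letI instRZ : Ring ↥Z := Subalgebra.toRing Z
  letI instSZ : Semiring ↥Z := instRZ.toSemiring
  letI : NonAssocSemiring ↥Z := instSZ.toNonAssocSemiring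
  letI : NonUnitalNonAssocSemiring ↥Z := instSZ.toNonUnitalSemiring.toNonUnitalNonAssocSemiring
  letI : AddCommGroup ↥Z := instRZ.toAddCommGroup
  letI : AddCommMonoid ↥Z := instRZ.toAddCommGroup.toAddCommMonoid
  letI : Monoid ↥Z := instSZ.toMonoidWithZero.toMonoid
  letI : Mul ↥Z := instSZ.toNonUnitalSemiring.toNonUnitalNonAssocSemiring.toMul
  letI : Add ↥Z := instRZ.toAddCommGroup.toAddGroup.toSubNegMonoid.toAddMonoid.toAddZeroClass.toAdd
  letI : Zero ↥Z := instSZ.toMonoidWithZero.toZero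
  letI : One ↥Z := instSZ.toOne
  have hcommZ : ∀ a b : ↥Z, a * b = b * a := fun a b => Subtype.ext (hcomm _ _ a.2 b.2)
  let τ : ↥Z →+* ↥Z :=
    { toFun := fun a => ⟨hermStar σ Hm a.1, hstar _ a.2⟩
      map_one' := Subtype.ext (hermStar_one σ Hm hH)
      map_mul' := fun a b => Subtype.ext (by
        change hermStar σ Hm (a.1 * b.1) = hermStar σ Hm a.1 * hermStar σ Hm b.1
        rw [hermStar_mul σ Hm hH, hcomm _ _ (hstar _ b.2) (hstar _ a.2)])
      map_zero' := Subtype.ext (by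
        change hermStar σ Hm (0 : Matrix (Fin 3) (Fin 3) (LocalRing L v)) = 0
        rw [← sub_self e, hermStar_sub', sub_self, sub_self])
      map_add' := fun a b => Subtype.ext (hermStar_add σ Hm _ _) }
  have hτval : ∀ a : ↥Z, (τ a).1 = hermStar σ Hm a.1 := fun _ => rfl
  have hτ : ∀ a, τ (τ a) = a := fun a => Subtype.ext (by rw [hτval, hτval, hermStar_hermStar σ Hm hH hσσ hHh])
  -- ### the ideal `(e)` and the quotient FIELD `Q = Z ∕ (e) ≅ (1−e)Z`: the ring-side work is scoped, only the field structure of `Q` survives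
  set eZ : ↥Z := ⟨e, heZ⟩ with heZ_def
  set I : Ideal ↥Z := Ideal.span {eZ} with hI_def
  let Q : Type := ↥Z ⧸ I
  have hI : ∀ y : ↥Z, y ∈ I ↔ (1 - e) * y.1 = 0 := by
    intro y
    rw [hI_def, Ideal.mem_span_singleton']
    constructor
    · rintro ⟨a, rfl⟩
      change (1 - e) * (a.1 * e) = 0
      rw [hcomm _ _ a.2 heZ, ← Matrix.mul_assoc, h1e, Matrix.zero_mul]
    · intro h
      refine ⟨y, Subtype.ext ?_⟩
      change y.1 * e = y.1
      rw [Matrix.sub_mul, Matrix.one_mul, sub_eq_zero] at h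
      rw [hcomm _ _ y.2 heZ]
      exact h.symm
  obtain ⟨instFQ, mkQ, τF, hmkQeq, hmkQsurj, hτFmk, hτF, hτF1⟩ :
      ∃ (_ : Field Q) (mkQ : ↥Z →+* Q) (τF : Q →+* Q), (∀ a b : ↥Z, mkQ a = mkQ b ↔ (1 - e) * a.1 = (1 - e) * b.1) ∧ Function.Surjective mkQ ∧
        (∀ a : ↥Z, τF (mkQ a) = mkQ (τ a)) ∧ (∀ q, τF (τF q) = q) ∧ τF ≠ RingHom.id _ := by
    letI instCZ : CommRing ↥Z := { toRing := instRZ, mul_comm := hcommZ }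
    haveI : I.IsTwoSided := ⟨fun b ha => by rw [hcommZ]; exact I.mul_mem_left b ha⟩
    haveI : RingHomClass (↥Z →+* ↥Z) ↥Z ↥Z := RingHom.instRingHomClass
    have hQeq : ∀ a b : ↥Z, (Ideal.Quotient.mk I a = Ideal.Quotient.mk I b) ↔ (1 - e) * a.1 = (1 - e) * b.1 := by
      intro a b
      rw [Ideal.Quotient.eq, hI]
      change (1 - e) * (a.1 - b.1) = 0 ↔ _
      rw [Matrix.mul_sub, sub_eq_zero]
    have hτI : I ≤ I.comap τ := by
      rw [hI_def, Ideal.span_le, Set.singleton_subset_iff, SetLike.mem_coe, Ideal.mem_comap]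
      have : τ eZ = eZ := Subtype.ext hes
      rw [this]
      exact Ideal.subset_span rfl
    let τQ : Q →+* Q := Ideal.quotientMap I τ hτI
    have hτQmk : ∀ a : ↥Z, τQ (Ideal.Quotient.mk I a) = Ideal.Quotient.mk I (τ a) := fun a => Ideal.quotientMap_mk
    have hτQ : ∀ q, τQ (τQ q) = q := by
      intro q
      obtain ⟨a, rfl⟩ := Ideal.Quotient.mk_surjective q
      rw [hτQmk, hτQmk, hτ]
    have hτQ1 : τQ ≠ RingHom.id _ := by
      intro hid
      -- `δ·1 ∈ Z` is moved: `τ(δ·1) = −δ·1`, so `τQ = id` would force `2δ·(1−e) = 0`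
      have hδZ : (algebraMap L (LocalRing L v) δ) • (1 : Matrix (Fin 3) (Fin 3) (LocalRing L v)) ∈ Z := Subalgebra.smul_mem _ (Subalgebra.one_mem _) _
      have hq := DFunLike.congr_fun hid (Ideal.Quotient.mk I ⟨_, hδZ⟩)
      rw [hτQmk, RingHom.id_apply, hQeq] at hq
      change (1 - e) * hermStar σ Hm ((algebraMap L (LocalRing L v) δ) • (1 : Matrix (Fin 3) (Fin 3) (LocalRing L v))) = (1 - e) * ((algebraMap L (LocalRing L v) δ) • (1 : Matrix (Fin 3) (Fin 3) (LocalRing L v))) at hq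
      rw [hermStar_smul, hermStar_one σ Hm hH, hσ_def, UnitaryGroup.conjLocal_algebraMap (IsCMField.complexConj L) v δ, hcδ, RingHom.map_neg, Matrix.mul_smul,
        Matrix.mul_smul, Matrix.mul_one, neg_smul, neg_eq_iff_add_eq_zero, ← add_smul, ← RingHom.map_add] at hq
      have h2δ : algebraMap L (LocalRing L v) (δ + δ) ≠ 0 :=
        ((algebraMap L (LocalRing L v)).injective.ne_iff' (RingHom.map_zero _)).2 (add_self_eq_zero.not.2 hδ)
      exact he1 (sub_eq_zero.1 (((hunit _ h2δ).smul_eq_zero).1 hq)).symm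
    -- `Q` is a field: the FIELD-corner letter
    have hQF : IsField Q := by
      refine ⟨⟨0, 1, fun h01 => h1e0 ?_⟩, ?_, ?_⟩
      · have h' : Ideal.Quotient.mk I 0 = Ideal.Quotient.mk I 1 := by rw [RingHom.map_zero, RingHom.map_one]; exact h01
        rw [hQeq] at h'
        change (1 - e) * (0 : Matrix (Fin 3) (Fin 3) (LocalRing L v)) = (1 - e) * 1 at h'
        rw [Matrix.mul_zero, Matrix.mul_one] at h'
        exact h'.symm
      · intro p q
        obtain ⟨a, rfl⟩ := Ideal.Quotient.mk_surjective p
        obtain ⟨b, rfl⟩ := Ideal.Quotient.mk_surjective q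
        rw [← RingHom.map_mul, ← RingHom.map_mul, hcommZ]
      · intro p hp
        obtain ⟨a, rfl⟩ := Ideal.Quotient.mk_surjective p
        have ha : (1 - e) * a.1 ≠ 0 := by
          intro h0
          apply hp
          rw [← RingHom.map_zero (Ideal.Quotient.mk I), hQeq, h0]
          change (0 : Matrix (Fin 3) (Fin 3) (LocalRing L v)) = (1 - e) * 0
          rw [Matrix.mul_zero]
        obtain ⟨y, hyZ, hy⟩ := hcorner a.1 a.2 ha
        refine ⟨Ideal.Quotient.mk I ⟨y, hyZ⟩, ?_⟩
        rw [← RingHom.map_mul, ← RingHom.map_one (Ideal.Quotient.mk I), hQeq]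
        change (1 - e) * (a.1 * y) = (1 - e) * 1
        rw [hy, Matrix.mul_one]
    exact ⟨hQF.toField, Ideal.Quotient.mk I, τQ, hQeq, Ideal.Quotient.mk_surjective, hτQmk, hτQ, hτQ1⟩
  letI := instFQ
  -- every algebraic class of `Q` used below, pinned to the field structure (local instances are found first, and consistently)
  letI := instFQ.toCommRing
  letI := instFQ.toCommRing.toRing
  letI := instFQ.toCommRing.toCommSemiring
  letI := instFQ.toCommRing.toRing.toSemiring
  letI := instFQ.toCommRing.toRing.toSemiring.toNonAssocSemiring
  letI := instFQ.toCommRing.toRing.toSemiring.toNonUnitalSemiring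
  letI := instFQ.toCommRing.toRing.toSemiring.toNonUnitalSemiring.toNonUnitalNonAssocSemiring
  letI := instFQ.toCommRing.toRing.toAddCommGroup
  letI := instFQ.toCommRing.toRing.toAddCommGroup.toAddCommMonoid
  letI := instFQ.toCommRing.toRing.toAddCommGroup.toAddGroup
  letI := instFQ.toCommRing.toRing.toAddGroupWithOne
  letI := instFQ.toCommRing.toRing.toAddGroupWithOne.toAddMonoidWithOne
  letI := instFQ.toCommRing.toCommMonoid
  letI := instFQ.toCommRing.toCommMonoid.toCommSemigroup
  letI := instFQ.toCommRing.toCommMonoid.toCommSemigroup.toCommMagma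
  letI := instFQ.toCommRing.toCommMonoid.toMonoid
  letI := instFQ.toCommRing.toCommMonoid.toMonoid.toSemigroup
  letI := instFQ.toCommRing.toCommMonoid.toMonoid.toMulOneClass
  letI := instFQ.toCommRing.toRing.toSemiring.toMonoidWithZero
  letI := instFQ.toCommRing.toRing.toSemiring.toMonoidWithZero.toMulZeroOneClass
  letI := instFQ.toCommRing.toRing.toSemiring.toMonoidWithZero.toMulZeroOneClass.toMulZeroClass
  letI := instFQ.toCommRing.toRing.toAddCommGroup.toAddGroup.toSubNegMonoid.toAddMonoid.toZero
  letI := instFQ.toCommRing.toRing.toAddCommGroup.toAddGroup.toSubNegMonoid.toAddMonoid.toAddZeroClass.toAdd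
  letI := instFQ.toCommRing.toRing.toSemiring.toOne
  letI := instFQ.toCommRing.toRing.toSemiring.toNonUnitalSemiring.toNonUnitalNonAssocSemiring.toMul
  letI := instFQ.toSemifield
  letI := instFQ.toSemifield.toDivisionSemiring
  letI := instFQ.toSemifield.toCommGroupWithZero
  letI := instFQ.toSemifield.toDivisionSemiring.toGroupWithZero
  letI := instFQ.toDivisionRing
  letI := instFQ.toDivisionRing.toNontrivial
  letI := instFQ.toDivisionRing.toDivInvMonoid
  letI := instFQ.toDivisionRing.toDivInvMonoid.toInv
  letI : DivisionMonoid Q := GroupWithZero.toDivisionMonoid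
  letI : DivisionCommMonoid Q := CommGroupWithZero.toDivisionCommMonoid
  letI : InvolutiveInv Q := DivisionMonoid.toInvolutiveInv
  haveI : NoZeroDivisors Q := GroupWithZero.noZeroDivisors
  -- ### `Q` as a finite extension of the local field `F_v` (explicit structure maps), then B-typ04 for `τF`
  haveI : CharZero (v.adicCompletion ↥(maximalRealSubfield L)) := charZero_of_injective_algebraMap (algebraMap ↥(maximalRealSubfield L) _).injective
  haveI : Module.Free (v.adicCompletion ↥(maximalRealSubfield L)) (LocalRing L v) := Module.Free.of_divisionRing _ _
  haveI : Module.Finite (v.adicCompletion ↥(maximalRealSubfield L)) (LocalRing L v) := moduleFinite_localRing L v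
  let ψ : (v.adicCompletion ↥(maximalRealSubfield L)) →+* ↥Z :=
    { toFun := fun q => ⟨(algebraMap (v.adicCompletion ↥(maximalRealSubfield L)) (LocalRing L v) q) • (1 : Matrix (Fin 3) (Fin 3) (LocalRing L v)), Subalgebra.smul_mem _ (Subalgebra.one_mem _) _⟩
      map_one' := Subtype.ext (by
        change (algebraMap (v.adicCompletion ↥(maximalRealSubfield L)) (LocalRing L v) 1) • (1 : Matrix (Fin 3) (Fin 3) (LocalRing L v)) = 1
        rw [RingHom.map_one, one_smul])
      map_mul' := fun a b => Subtype.ext (by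
        change (algebraMap (v.adicCompletion ↥(maximalRealSubfield L)) (LocalRing L v) (a * b)) • (1 : Matrix (Fin 3) (Fin 3) (LocalRing L v)) = (algebraMap (v.adicCompletion ↥(maximalRealSubfield L)) (LocalRing L v) a) • (1 : Matrix (Fin 3) (Fin 3) (LocalRing L v)) * (algebraMap (v.adicCompletion ↥(maximalRealSubfield L)) (LocalRing L v) b) • (1 : Matrix (Fin 3) (Fin 3) (LocalRing L v))
        rw [RingHom.map_mul, Matrix.smul_mul, Matrix.one_mul, smul_smul])
      map_zero' := Subtype.ext (by
        change (algebraMap (v.adicCompletion ↥(maximalRealSubfield L)) (LocalRing L v) 0) • (1 : Matrix (Fin 3) (Fin 3) (LocalRing L v)) = 0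
        rw [RingHom.map_zero, zero_smul])
      map_add' := fun a b => Subtype.ext (by
        change (algebraMap (v.adicCompletion ↥(maximalRealSubfield L)) (LocalRing L v) (a + b)) • (1 : Matrix (Fin 3) (Fin 3) (LocalRing L v)) = (algebraMap (v.adicCompletion ↥(maximalRealSubfield L)) (LocalRing L v) a) • (1 : Matrix (Fin 3) (Fin 3) (LocalRing L v)) + (algebraMap (v.adicCompletion ↥(maximalRealSubfield L)) (LocalRing L v) b) • (1 : Matrix (Fin 3) (Fin 3) (LocalRing L v))
        rw [RingHom.map_add, add_smul]) }
  letI : Algebra (v.adicCompletion ↥(maximalRealSubfield L)) ↥Z := ψ.toAlgebra' fun q a => hcommZ (ψ q) a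
  letI : Module (v.adicCompletion ↥(maximalRealSubfield L)) ↥Z := Algebra.toModule
  haveI : FiniteDimensional (v.adicCompletion ↥(maximalRealSubfield L)) ↥Z := by
    refine FiniteDimensional.of_injective
      ({ toFun := fun a => a.1, map_add' := fun _ _ => rfl, map_smul' := fun q a => ?_ } : ↥Z →ₗ[(v.adicCompletion ↥(maximalRealSubfield L))] Matrix (Fin 3) (Fin 3) (LocalRing L v)) (fun a b h => Subtype.ext h)
    change ((algebraMap (v.adicCompletion ↥(maximalRealSubfield L)) (LocalRing L v) q) • (1 : Matrix (Fin 3) (Fin 3) (LocalRing L v))) * a.1 = q • a.1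
    rw [Matrix.smul_mul, Matrix.one_mul]
    rfl
  let φ : (v.adicCompletion ↥(maximalRealSubfield L)) →+* Q := mkQ.comp ψ
  letI : Algebra (v.adicCompletion ↥(maximalRealSubfield L)) Q := φ.toAlgebra
  letI : Module (v.adicCompletion ↥(maximalRealSubfield L)) Q := Algebra.toModule
  haveI : FiniteDimensional (v.adicCompletion ↥(maximalRealSubfield L)) Q := by
    refine Module.Finite.of_surjective ({ toFun := mkQ, map_add' := RingHom.map_add mkQ, map_smul' := fun q a => ?_ } : ↥Z →ₗ[(v.adicCompletion ↥(maximalRealSubfield L))] Q) hmkQsurj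
    change mkQ (ψ q * a) = mkQ (ψ q) * mkQ a
    exact RingHom.map_mul _ _ _
  haveI : CharZero Q := charZero_of_injective_algebraMap (algebraMap (v.adicCompletion ↥(maximalRealSubfield L)) Q).injective
  obtain ⟨cq, hcqτ, hcq0, hcqn, hdich⟩ : ∃ cq : Q, τF cq = cq ∧ cq ≠ 0 ∧ (∀ z, z * τF z ≠ cq) ∧ ∀ s, τF s = s → s ≠ 0 → (∃ z, z * τF z = s) ∨ ∃ z, z * τF z = cq * s := by
    obtain ⟨rQ, tQ, hlocQ, -⟩ := FiniteExtension.exists_isNonarchimedeanLocalField (v.adicCompletion ↥(maximalRealSubfield L)) Q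
    letI := rQ
    letI := tQ
    haveI := hlocQ
    exact LocalFieldInvolutionNorm.exists_fixed_nonnorm_dichotomy τF hτF hτF1
  have hτFinv : ∀ q : Q, q ≠ 0 → τF q⁻¹ = (τF q)⁻¹ := by
    intro q hq
    refine eq_inv_of_mul_eq_one_right ?_
    rw [← RingHom.map_mul τF, mul_inv_cancel₀ hq]
    exact RingHom.map_one τF
  -- ### reading the two classes of `Q^{τ×} ∕ N` back in `Z` modulo `e`
  obtain ⟨c', hc'⟩ := hmkQsurj cq
  obtain ⟨c'', hc''⟩ := hmkQsurj cq⁻¹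
  refine ⟨c'.1, c'.2, ?_, ⟨c''.1, c''.2, ?_⟩, ?_, ?_⟩
  · have h := hcqτ
    rw [← hc', hτFmk, hmkQeq] at h
    exact h
  · have hcc : (1 - e) * (c'.1 * c''.1) = (1 - e) * 1 :=
      (hmkQeq (c' * c'') 1).1 (by rw [RingHom.map_mul, hc', hc'', mul_inv_cancel₀ hcq0]; exact (RingHom.map_one _).symm)
    rw [hcc, Matrix.mul_one]
  · rintro t htZ ⟨t', ht'Z, htt'⟩ hk
    let tZ : ↥Z := ⟨t, htZ⟩
    have hzt0 : mkQ tZ ≠ 0 := by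
      intro h0
      have h1 : mkQ (tZ * ⟨t', ht'Z⟩) = 1 := by
        rw [← RingHom.map_one mkQ, hmkQeq]
        change (1 - e) * (t * t') = (1 - e) * 1
        rw [htt', Matrix.mul_one]
      rw [RingHom.map_mul, h0, zero_mul] at h1
      exact zero_ne_one h1
    have h1 : mkQ (c' * (τ tZ * tZ)) = 1 := by
      rw [← RingHom.map_one mkQ, hmkQeq]
      change (1 - e) * (c'.1 * (hermStar σ Hm t * t)) = (1 - e) * 1
      rw [hk, Matrix.mul_one]
    rw [RingHom.map_mul, RingHom.map_mul, ← hτFmk, hc'] at h1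
    have hzt : τF (mkQ tZ) * mkQ tZ = cq⁻¹ := eq_inv_of_mul_eq_one_right h1
    refine hcqn (mkQ tZ)⁻¹ ?_
    rw [hτFinv _ hzt0, ← mul_inv, mul_comm, hzt, inv_inv]
  · intro s hsZ hss hs0
    let sZ : ↥Z := ⟨s, hsZ⟩
    let sq : Q := mkQ sZ
    have hsq_def : sq = mkQ sZ := rfl
    have hsq0 : sq ≠ 0 := by
      intro h
      have h' := (hmkQeq sZ 0).1 (h.trans (RingHom.map_zero mkQ).symm)
      change (1 - e) * s = (1 - e) * 0 at h'
      rw [Matrix.mul_zero] at h'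
      exact hs0 h'
    have hsqτ : τF sq = sq := by
      rw [hsq_def, hτFmk, hmkQeq]
      exact hss
    have hs1 : τF sq⁻¹ = sq⁻¹ := by rw [hτFinv _ hsq0, hsqτ]
    -- a corner datum `β` from a class equation `z·τz = ρ̄·s̄⁻¹`
    have hlift : ∀ (zq : Q) (ρ : ↥Z), mkQ ρ ≠ 0 → zq * τF zq = mkQ ρ * sq⁻¹ →
        ∃ β ∈ Z, ∃ β' ∈ Z, (1 - e) * (β * β') = 1 - e ∧ (1 - e) * (s * (hermStar σ Hm β * β)) = (1 - e) * ρ.1 := by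
      intro zq ρ hρ0 hzq
      have hzq0 : zq ≠ 0 := by
        rintro rfl
        rw [zero_mul] at hzq
        exact mul_ne_zero hρ0 (inv_ne_zero hsq0) hzq.symm
      obtain ⟨β, hβ⟩ := hmkQsurj zq
      obtain ⟨β', hβ'⟩ := hmkQsurj zq⁻¹
      refine ⟨β.1, β.2, β'.1, β'.2, ?_, ?_⟩
      · have h := (hmkQeq (β * β') 1).1 (by rw [RingHom.map_mul, hβ, hβ', mul_inv_cancel₀ hzq0]; exact (RingHom.map_one _).symm)
        change (1 - e) * (β.1 * β'.1) = (1 - e) * 1 at h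
        rw [h, Matrix.mul_one]
      · have h : mkQ (sZ * (τ β * β)) = mkQ ρ := by
          rw [RingHom.map_mul, RingHom.map_mul, ← hτFmk, hβ, ← hsq_def, mul_comm (τF zq) zq, hzq, mul_comm (mkQ ρ) sq⁻¹, ← mul_assoc,
            mul_inv_cancel₀ hsq0, one_mul]
        exact (hmkQeq (sZ * (τ β * β)) ρ).1 h
    rcases hdich sq⁻¹ hs1 (inv_ne_zero hsq0) with ⟨zq, hzq⟩ | ⟨zq, hzq⟩
    · have h10 : mkQ 1 ≠ 0 := by rw [RingHom.map_one]; exact one_ne_zero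
      obtain ⟨β, hβZ, β', hβ'Z, h1, h2⟩ := hlift zq 1 h10 (by rw [RingHom.map_one, one_mul]; exact hzq)
      refine ⟨β, hβZ, β', hβ'Z, h1, Or.inl ?_⟩
      rw [h2]
      change (1 - e) * (1 : Matrix (Fin 3) (Fin 3) (LocalRing L v)) = 1 - e
      rw [Matrix.mul_one]
    · have hc0 : mkQ c' ≠ 0 := by rw [hc']; exact hcq0
      obtain ⟨β, hβZ, β', hβ'Z, h1, h2⟩ := hlift zq c' hc0 (by rw [hc']; exact hzq)
      exact ⟨β, hβZ, β', hβ'Z, h1, Or.inr h2⟩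

end TypeTwo

end Summit.HodgeConjecture.HodgeConjecture.R90.S4

end
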